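import Literature.Analysis.Fourier.TelescopingPieceBounds
import Literature.MathematicalPhysics.StatisticalMechanics.TorusLatticeSums
import HarnessLib

/-!
# The base multipliers of the torus finite-range decomposition and their shell bounds

Topic `Literature/MathematicalPhysics/StatisticalMechanics`.  The Fourier multipliers of the base
decomposition (Buchholz, J. Funct. Anal. 275 (2018), Thm 2.3) in the scalar case `m = 1`: for
`A ∈ 𝓛(ω₀, Ω₀)` and `κ ≠ 0`,

  `ĉ_k(A, κ) = c_k(â(κ))`,  `c_k` the telescoping pieces of `TelescopingLowPassPieces.lean` with band
  `B = 2dΩ₀` (so that the spectrum `â(κ) ∈ (0, 2B]`),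

(`baseMult`), together with the bounds of Thm 2.3 (v) in the form used by Prop 3.1, for the
directional derivatives `∂_s^ℓ ĉ_k(A + sȦ, κ)|_{s=0}` with `‖Ȧ‖ ≤ 1` (`IsUnitSymm`), all `ℓ ≥ 0`:

* `iteratedDeriv_baseMult` — `∂_s^ℓ ĉ_k(A+sȦ) = ḃ^ℓ c_k^{(ℓ)}(â)`, `ḃ = symbR Ȧ κ`, `|ḃ| ≤ â/ω₀`;
* `exists_baseMult_deriv_le_pow` — `|∂_s^ℓ ĉ_k| ≤ U L^{2k}` (Buchholz (2.26), second case);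
* `exists_baseMult_deriv_le_decay` — `|∂_s^ℓ ĉ_k| ≤ U |p|^{-2} (|p| L^{k-1})^{-n̄}` for every `n̄`
  (Buchholz (2.26), first case — for ALL `ℓ`, the improvement of Thm 2.4);
* `baseMult_ge_pow`, `baseMult_one_ge` — the lower bounds (2.27); `baseMult_nonneg`, `sum_baseMult`
  (`Σ_k ĉ_k = 1/â`), `contDiffOn_baseMult` (analyticity in `s` on `|s| < ω₀`).

Everything is proved; no named facts.

## References
* S. Buchholz, *Finite range decomposition for Gaussian measures with improved regularity*,
  J. Funct. Anal. 275 (2018), Thm 2.3 (2.25)–(2.27), §2 (2.19)–(2.20) [Buchholz2016].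
-/

noncomputable section

namespace Literature.MathematicalPhysics.StatisticalMechanics.GradientFRD

open Finset Literature.Analysis.Fourier Literature.Probability.LatticeModels
open scoped Real BigOperators

variable {d M : ℕ} [NeZero M]

/-! ## The band and the spectrum -/

/-- The band `B = 2dΩ₀`: the symbols of `𝓛(ω₀,Ω₀)` lie in `(0, 2B]`. [cite: Buchholz2016, §2 (2.19)] -/
def band (d : ℕ) (Ω₀ : ℝ) : ℝ := 2 * d * Ω₀

/-- `|q(κ)|² ≤ 4d`. [cite: Buchholz2016, §2 (2.19)] -/
theorem qnormSq_le (κ : Fin d → ZMod M) : qnormSq κ ≤ 4 * d := by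
  unfold qnormSq
  have h : ∀ j : Fin d, ‖qmode κ j‖ ^ 2 ≤ 4 := fun j => by
    rw [norm_qmode_sq]
    have := Real.sin_sq_le_one (dualMomentum κ j / 2)
    linarith
  calc ∑ j, ‖qmode κ j‖ ^ 2 ≤ ∑ _j : Fin d, (4 : ℝ) := sum_le_sum fun j _ => h j
    _ = 4 * d := by rw [sum_const, card_univ, Fintype.card_fin, nsmul_eq_mul, mul_comm]

/-- `0 ≤ |q|²`. [cite: Buchholz2016, §2 (2.19)] -/
theorem qnormSq_nonneg (κ : Fin d → ZMod M) : 0 ≤ qnormSq κ := sum_nonneg fun _ _ => sq_nonneg _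

/-- The spectrum of an elliptic symbol: `0 < â(κ) ≤ 2B` for `κ ≠ 0`, and
`(4ω₀/π²)|p|² ≤ â ≤ Ω₀ |p|²`. [cite: Buchholz2016, §2 (2.19)–(2.20)] -/
theorem symbR_spectrum {ω₀ Ω₀ : ℝ} (hω : 0 < ω₀) {A : Matrix (Fin d) (Fin d) ℝ} (hA : IsElliptic ω₀ Ω₀ A)
    {κ : Fin d → ZMod M} (hκ : κ ≠ 0) :
    0 < symbR A κ ∧ symbR A κ ≤ 2 * band d Ω₀ ∧
      4 * ω₀ / π ^ 2 * momNorm κ ^ 2 ≤ symbR A κ ∧ symbR A κ ≤ Ω₀ * momNorm κ ^ 2 := by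
  have hb := symbR_bounds hA κ
  have hq := qnormSq_bounds κ
  have hpos := symbR_pos hA hω hκ
  have hΩ : 0 ≤ Ω₀ := by
    have h1 : ω₀ * qnormSq κ ≤ Ω₀ * qnormSq κ := hb.1.trans hb.2
    have h2 := qnormSq_pos hκ
    nlinarith
  refine ⟨hpos, ?_, ?_, ?_⟩
  · calc symbR A κ ≤ Ω₀ * qnormSq κ := hb.2
      _ ≤ Ω₀ * (4 * d) := mul_le_mul_of_nonneg_left (qnormSq_le κ) hΩ
      _ = 2 * band d Ω₀ := by rw [band]; ring
  · calc 4 * ω₀ / π ^ 2 * momNorm κ ^ 2 = ω₀ * (4 / π ^ 2 * momNorm κ ^ 2) := by ring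
      _ ≤ ω₀ * qnormSq κ := mul_le_mul_of_nonneg_left hq.1 hω.le
      _ ≤ symbR A κ := hb.1
  · exact hb.2.trans (mul_le_mul_of_nonneg_left hq.2 hΩ)

/-- `Ω₀ ≤ B` (for `d ≥ 1`, `Ω₀ ≥ 0`) and `0 < B`. [cite: Buchholz2016, §2] -/
theorem band_pos_of {Ω₀ : ℝ} (hΩ : 0 < Ω₀) (hd : 1 ≤ d) : 0 < band d Ω₀ ∧ Ω₀ ≤ band d Ω₀ := by
  have hd' : (1 : ℝ) ≤ d := by exact_mod_cast hd
  unfold band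
  constructor <;> nlinarith

/-- A unit symmetric direction has symbol `|ḃ(κ)| ≤ â(κ)/ω₀`. [cite: Buchholz2016, Thm 2.4 (‖Ȧ‖ ≤ 1)] -/
theorem abs_symbR_dir_le {ω₀ Ω₀ : ℝ} (hω : 0 < ω₀) {A : Matrix (Fin d) (Fin d) ℝ} (hA : IsElliptic ω₀ Ω₀ A)
    {B' : Matrix (Fin d) (Fin d) ℝ} (hB' : IsUnitSymm B') (κ : Fin d → ZMod M) :
    |symbR B' κ| ≤ symbR A κ / ω₀ := by
  rw [le_div_iff₀ hω]
  have h1 := abs_symbR_le hB' κ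
  have h2 := (symbR_bounds hA κ).1
  nlinarith [abs_nonneg (symbR B' κ)]

/-! ## The base multipliers -/

/-- The base multiplier `ĉ_k(A, κ) = c_k(â(κ))` (band `B = 2dΩ₀`). [cite: Buchholz2016, Thm 2.3] -/
def baseMult (Ω₀ : ℝ) (L N k : ℕ) (A : Matrix (Fin d) (Fin d) ℝ) (κ : Fin d → ZMod M) : ℝ :=
  piece (band d Ω₀) L N k (symbR A κ)

/-- `ĉ_k ≥ 0`. [cite: Buchholz2016, Thm 2.3 (positivity)] -/
theorem baseMult_nonneg {ω₀ Ω₀ : ℝ} (hω : 0 < ω₀) (hωΩ : ω₀ < Ω₀) (hd : 1 ≤ d) {A : Matrix (Fin d) (Fin d) ℝ}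
    (hA : IsElliptic ω₀ Ω₀ A) (L N k : ℕ) {κ : Fin d → ZMod M} (hκ : κ ≠ 0) : 0 ≤ baseMult Ω₀ L N k A κ := by
  have hs := symbR_spectrum hω hA hκ
  have hB := band_pos_of (d := d) (hω.trans hωΩ) hd
  exact piece_nonneg hB.1 L N k hs.1 (by linarith [hs.2.1])

/-- **The base multipliers sum to the covariance symbol**: `Σ_{k=1}^{N+1} ĉ_k(A,κ) = 1/â(κ)` (`κ ≠ 0`).
[cite: Buchholz2016, Thm 2.3 (𝒞_A = Σ 𝒞_{A,k})] -/
theorem sum_baseMult {ω₀ Ω₀ : ℝ} (hω : 0 < ω₀) {A : Matrix (Fin d) (Fin d) ℝ} (hA : IsElliptic ω₀ Ω₀ A) (L N : ℕ)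
    {κ : Fin d → ZMod M} (hκ : κ ≠ 0) : ∑ k ∈ Finset.Icc 1 (N + 1), baseMult Ω₀ L N k A κ = 1 / symbR A κ :=
  sum_piece _ L N (symbR_pos hA hω hκ).ne'

/-! ## Directional derivatives -/

/-- Positivity of `Ω₀` in a nonempty ellipticity class (used to get `B > 0`). [cite: Buchholz2016, §2] -/
theorem ellipt_Omega_pos {ω₀ Ω₀ : ℝ} (hω : 0 < ω₀) (hωΩ : ω₀ < Ω₀) : 0 < Ω₀ := hω.trans hωΩ

/-- **Directional derivatives of the base multipliers**: for `κ ≠ 0`,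
`∂_s^ℓ ĉ_k(A + sȦ, κ)|_{s=0} = ḃ(κ)^ℓ c_k^{(ℓ)}(â(κ))`. [cite: Buchholz2016, App. A (A.9)–(A.10)] -/
theorem iteratedDeriv_baseMult {ω₀ Ω₀ : ℝ} (hω : 0 < ω₀) {A : Matrix (Fin d) (Fin d) ℝ} (hA : IsElliptic ω₀ Ω₀ A)
    (B' : Matrix (Fin d) (Fin d) ℝ) (L N k : ℕ) {κ : Fin d → ZMod M} (hκ : κ ≠ 0) (ℓ : ℕ) :
    iteratedDeriv ℓ (fun s : ℝ => baseMult Ω₀ L N k (A + s • B') κ) 0 =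
      symbR B' κ ^ ℓ * iteratedDeriv ℓ (piece (band d Ω₀) L N k) (symbR A κ) := by
  have hfun : (fun s : ℝ => baseMult Ω₀ L N k (A + s • B') κ) =
      fun s => piece (band d Ω₀) L N k (symbR A κ + s * symbR B' κ) := by
    funext s; rw [baseMult, symbR_add_smul]
  rw [hfun]
  have h := iteratedDeriv_comp_affine isOpen_Ioi (contDiffOn_piece (band d Ω₀) L N k) (symbR A κ) (symbR B' κ) ℓ 0
    (by rw [zero_mul, add_zero]; exact symbR_pos hA hω hκ)
  rw [h, zero_mul, add_zero]

/-- **Analyticity in the direction**: `s ↦ ĉ_k(A + sȦ, κ)` is analytic on `|s| < ω₀`.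
[cite: Buchholz2016, Thm 2.4 ("real analytic")] -/
theorem contDiffOn_baseMult {ω₀ Ω₀ : ℝ} (hω : 0 < ω₀) {A : Matrix (Fin d) (Fin d) ℝ} (hA : IsElliptic ω₀ Ω₀ A)
    {B' : Matrix (Fin d) (Fin d) ℝ} (hB' : IsUnitSymm B') (L N k : ℕ) (κ : Fin d → ZMod M) {n : WithTop ℕ∞} :
    ContDiffOn ℝ n (fun s : ℝ => baseMult Ω₀ L N k (A + s • B') κ) (Set.Ioo (-ω₀) ω₀) := by
  rcases eq_or_ne κ 0 with hκ | hκ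
  · -- at `κ = 0` the symbol vanishes identically and the multiplier is constant
    have : (fun s : ℝ => baseMult Ω₀ L N k (A + s • B') κ) = fun _ => piece (band d Ω₀) L N k 0 := by
      funext s; rw [baseMult, hκ, symbR_zero]
    rw [this]; exact contDiffOn_const
  · have hfun : (fun s : ℝ => baseMult Ω₀ L N k (A + s • B') κ) =
        (piece (band d Ω₀) L N k) ∘ fun s => symbR A κ + s * symbR B' κ := by
      funext s; simp only [Function.comp, baseMult, symbR_add_smul]
    rw [hfun]
    refine (contDiffOn_piece (band d Ω₀) L N k).comp (by fun_prop) fun s hs => ?_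
    -- `â + s ḃ > 0` for `|s| < ω₀`
    rw [Set.mem_Ioo] at hs
    have ha := symbR_pos hA hω hκ
    have hb := abs_symbR_dir_le hω hA hB' κ
    show 0 < symbR A κ + s * symbR B' κ
    have hs' : |s| < ω₀ := abs_lt.2 ⟨hs.1, hs.2⟩
    have h1 : |s * symbR B' κ| < symbR A κ := by
      rw [abs_mul]
      calc |s| * |symbR B' κ| ≤ |s| * (symbR A κ / ω₀) := mul_le_mul_of_nonneg_left hb (abs_nonneg _)
        _ < ω₀ * (symbR A κ / ω₀) := mul_lt_mul_of_pos_right hs' (div_pos ha hω)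
        _ = symbR A κ := by field_simp
    linarith [neg_abs_le (s * symbR B' κ)]

/-! ## Shell bounds for the directional derivatives -/

/-- From the symbol bound to the directional derivative: `|∂_s^ℓ ĉ_k| ≤ ω₀^{-ℓ} â^ℓ |c_k^{(ℓ)}(â)|`.
[cite: Buchholz2016, Thm 2.3 (2.26)] -/
theorem abs_iteratedDeriv_baseMult_le {ω₀ Ω₀ : ℝ} (hω : 0 < ω₀) {A : Matrix (Fin d) (Fin d) ℝ}
    (hA : IsElliptic ω₀ Ω₀ A) {B' : Matrix (Fin d) (Fin d) ℝ} (hB' : IsUnitSymm B') (L N k : ℕ)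
    {κ : Fin d → ZMod M} (hκ : κ ≠ 0) (ℓ : ℕ) :
    |iteratedDeriv ℓ (fun s : ℝ => baseMult Ω₀ L N k (A + s • B') κ) 0| ≤
      (ω₀⁻¹) ^ ℓ * (symbR A κ ^ ℓ * |iteratedDeriv ℓ (piece (band d Ω₀) L N k) (symbR A κ)|) := by
  rw [iteratedDeriv_baseMult hω hA B' L N k hκ, abs_mul, abs_pow]
  have hb := abs_symbR_dir_le hω hA hB' κ
  have ha := symbR_pos hA hω hκ
  calc |symbR B' κ| ^ ℓ * |iteratedDeriv ℓ (piece (band d Ω₀) L N k) (symbR A κ)|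
      ≤ (symbR A κ / ω₀) ^ ℓ * |iteratedDeriv ℓ (piece (band d Ω₀) L N k) (symbR A κ)| :=
        mul_le_mul_of_nonneg_right (pow_le_pow_left₀ (abs_nonneg _) hb ℓ) (abs_nonneg _)
    _ = (ω₀⁻¹) ^ ℓ * (symbR A κ ^ ℓ * |iteratedDeriv ℓ (piece (band d Ω₀) L N k) (symbR A κ)|) := by
        rw [div_eq_mul_inv, mul_pow]; ring

/-- For `κ ≠ 0`: `1/|p|² ≤ L^{2N}/(4π²)` on the torus of side `M = L^N` (since `|p| ≥ 2π/M`).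
[cite: Buchholz2016, §2 (dual torus)] -/
theorem inv_momNorm_sq_le {L N : ℕ} (hL : 5 ≤ L) (hM : M = L ^ N) {κ : Fin d → ZMod M} (hκ : κ ≠ 0) :
    (momNorm κ ^ 2)⁻¹ ≤ (L : ℝ) ^ (2 * N) / (4 * π ^ 2) := by
  have hMpos : (0 : ℝ) < M := by exact_mod_cast Nat.pos_of_ne_zero (NeZero.ne M)
  have hL0 : (0 : ℝ) < L := by exact_mod_cast (show 0 < L by omega)
  have h1 : 2 * π / M ≤ momNorm κ := by
    have h := supNorm_le_momNorm κ
    have hs : (1 : ℝ) ≤ supNorm κ := by exact_mod_cast one_le_supNorm hκ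
    calc 2 * π / M = 2 * π / M * 1 := (mul_one _).symm
      _ ≤ 2 * π / M * (supNorm κ : ℝ) := mul_le_mul_of_nonneg_left hs (by positivity)
      _ ≤ momNorm κ := h
  have h2 : (2 * π / M) ^ 2 ≤ momNorm κ ^ 2 := pow_le_pow_left₀ (by positivity) h1 2
  rw [inv_le_comm₀ (lt_of_lt_of_le (by positivity) h2) (by positivity)]
  refine le_trans (le_of_eq ?_) h2
  rw [hM]; push_cast
  rw [div_pow, mul_pow, ← pow_mul, mul_comm N 2]
  field_simp
  norm_num

/-- **Upper bound, small momenta (Buchholz (2.26), second case)**: for every `ℓ` there is `U` with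
`|∂_s^ℓ ĉ_k(A+sȦ,κ)| ≤ U L^{2k}` for all `1 ≤ k ≤ N+1`, `κ ≠ 0`, `A ∈ 𝓛(ω₀,Ω₀)`, `‖Ȧ‖ ≤ 1`, `L ≥ 5`,
`N ≥ 1`, `M = L^N`. [cite: Buchholz2016, Thm 2.3 (2.26)] -/
theorem exists_baseMult_deriv_le_pow (d : ℕ) (hd : 1 ≤ d) {ω₀ Ω₀ : ℝ} (hω : 0 < ω₀) (hωΩ : ω₀ < Ω₀) (ℓ : ℕ) :
    ∃ U, 0 ≤ U ∧ ∀ (L N M : ℕ) [NeZero M], 5 ≤ L → 1 ≤ N → M = L ^ N →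
      ∀ A : Matrix (Fin d) (Fin d) ℝ, IsElliptic ω₀ Ω₀ A → ∀ B' : Matrix (Fin d) (Fin d) ℝ, IsUnitSymm B' →
        ∀ k, 1 ≤ k → k ≤ N + 1 → ∀ κ : Fin d → ZMod M, κ ≠ 0 →
          |iteratedDeriv ℓ (fun s : ℝ => baseMult Ω₀ L N k (A + s • B') κ) 0| ≤ U * (L : ℝ) ^ (2 * k) := by
  have hΩ := ellipt_Omega_pos hω hωΩ
  obtain ⟨hB, hΩB⟩ := band_pos_of (d := d) hΩ hd
  set B : ℝ := band d Ω₀ with hBdef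
  obtain ⟨U1, hU10, hU1⟩ := exists_abs_iteratedDeriv_piece_le ℓ 0
  obtain ⟨U2, hU20, hU2⟩ := exists_abs_iteratedDeriv_piece_last_le ℓ 0
  -- constants: `k ≤ N`: ω₀^{-ℓ} U1 /(4B)`; `k = N+1`: `ω₀^{-ℓ} U2 (π²/(4ω₀)) /(4π²)`
  set U : ℝ := (ω₀⁻¹) ^ ℓ * (U1 / (4 * B) + U2 / (16 * ω₀)) with hU
  refine ⟨U, by positivity, fun L N M _ hL hN hM A hA B' hB' k hk1 hk κ hκ => ?_⟩
  have hs := symbR_spectrum hω hA hκ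
  set a := symbR A κ with ha
  have ha0 : 0 < a := hs.1
  have hL0 : (0 : ℝ) < L := by exact_mod_cast (show 0 < L by omega)
  refine (abs_iteratedDeriv_baseMult_le hω hA hB' L N k hκ ℓ).trans ?_
  rcases le_or_gt k N with hkN | hkN
  · have h := hU1 B hB L hL N k hk1 hkN a hs.1 hs.2.1
    have hmin := min_scale_le hB hL hk1 a
    calc (ω₀⁻¹) ^ ℓ * (a ^ ℓ * |iteratedDeriv ℓ (piece B L N k) a|)
        ≤ (ω₀⁻¹) ^ ℓ * (U1 * 1 * ((L : ℝ) ^ (2 * k) / (4 * B))) := by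
          refine mul_le_mul_of_nonneg_left (h.trans ?_) (by positivity)
          exact mul_le_mul (mul_le_mul_of_nonneg_left (min_le_left _ _) hU10) hmin
            (le_min (div_nonneg (sq_nonneg _) hB.le) (div_nonneg zero_le_one hs.1.le)) (by positivity)
      _ = (ω₀⁻¹) ^ ℓ * (U1 / (4 * B)) * (L : ℝ) ^ (2 * k) := by ring
      _ ≤ U * (L : ℝ) ^ (2 * k) := by
          refine mul_le_mul_of_nonneg_right ?_ (by positivity)
          rw [hU]; refine mul_le_mul_of_nonneg_left ?_ (by positivity)
          have : 0 ≤ U2 / (16 * ω₀) := by positivity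
          linarith
  · have hkN1 : k = N + 1 := by omega
    subst hkN1
    have h := hU2 B hB L hL N hN a hs.1 hs.2.1
    have hp := inv_momNorm_sq_le hL hM hκ
    -- `1/a ≤ π²/(4ω₀) · 1/|p|² ≤ π²/(4ω₀) · L^{2N}/(4π²)`
    have hainv : 1 / a ≤ π ^ 2 / (4 * ω₀) * ((L : ℝ) ^ (2 * N) / (4 * π ^ 2)) := by
      have h1 : 4 * ω₀ / π ^ 2 * momNorm κ ^ 2 ≤ a := hs.2.2.1
      have hp0 := momNorm_pos hκ
      calc 1 / a ≤ 1 / (4 * ω₀ / π ^ 2 * momNorm κ ^ 2) := by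
            exact one_div_le_one_div_of_le (by positivity) h1
        _ = π ^ 2 / (4 * ω₀) * (momNorm κ ^ 2)⁻¹ := by field_simp
        _ ≤ π ^ 2 / (4 * ω₀) * ((L : ℝ) ^ (2 * N) / (4 * π ^ 2)) := mul_le_mul_of_nonneg_left hp (by positivity)
    calc (ω₀⁻¹) ^ ℓ * (a ^ ℓ * |iteratedDeriv ℓ (piece B L N (N + 1)) a|)
        ≤ (ω₀⁻¹) ^ ℓ * (U2 * 1 / a) := by
          refine mul_le_mul_of_nonneg_left (h.trans ?_) (by positivity)
          exact div_le_div_of_nonneg_right (mul_le_mul_of_nonneg_left (min_le_left _ _) hU20) hs.1.le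
      _ = (ω₀⁻¹) ^ ℓ * U2 * (1 / a) := by ring
      _ ≤ (ω₀⁻¹) ^ ℓ * U2 * (π ^ 2 / (4 * ω₀) * ((L : ℝ) ^ (2 * N) / (4 * π ^ 2))) :=
          mul_le_mul_of_nonneg_left hainv (by positivity)
      _ = (ω₀⁻¹) ^ ℓ * (U2 / (16 * ω₀)) * (L : ℝ) ^ (2 * N) := by field_simp; ring
      _ ≤ U * (L : ℝ) ^ (2 * (N + 1)) := by
          have hL1 : (1 : ℝ) ≤ L := by exact_mod_cast (show 1 ≤ L by omega)
          have hpow : (L : ℝ) ^ (2 * N) ≤ (L : ℝ) ^ (2 * (N + 1)) := pow_le_pow_right₀ hL1 (by omega)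
          have hcoef : (ω₀⁻¹) ^ ℓ * (U2 / (16 * ω₀)) ≤ U := by
            rw [hU]; refine mul_le_mul_of_nonneg_left ?_ (by positivity)
            have : 0 ≤ U1 / (4 * B) := by positivity
            linarith
          exact mul_le_mul hcoef hpow (by positivity) (by positivity)

/-- Turning the decay factor into powers of `|p| L^{k-1}`: for `u ≥ c x²`, `x > 0`, `c > 0`, `n̄ ≤ 2j`:
`min(1, u^{-j}) ≤ max(1, c^{-j}) (x^{n̄})^{-1}`. [cite: Buchholz2016, Thm 2.3 (2.26)] -/
theorem min_decay_le_pow {u c x : ℝ} (hc : 0 < c) (hx : 0 < x) (hu : c * x ^ 2 ≤ u) {j n : ℕ} (hn : n ≤ 2 * j) :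
    min 1 (u⁻¹ ^ j) ≤ max 1 (c⁻¹ ^ j) * (x ^ n)⁻¹ := by
  have hupos : 0 < u := lt_of_lt_of_le (by positivity) hu
  rcases le_or_gt 1 x with h1 | h1
  · -- `x ≥ 1`: use the decay
    calc min 1 (u⁻¹ ^ j) ≤ u⁻¹ ^ j := min_le_right _ _
      _ ≤ (c * x ^ 2)⁻¹ ^ j := pow_le_pow_left₀ (by positivity) (by rw [inv_le_inv₀ hupos (by positivity)]; exact hu) j
      _ = c⁻¹ ^ j * (x ^ (2 * j))⁻¹ := by rw [mul_inv, mul_pow, inv_pow, inv_pow, pow_mul]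
      _ ≤ max 1 (c⁻¹ ^ j) * (x ^ n)⁻¹ := by
          refine mul_le_mul (le_max_right _ _) ?_ (by positivity) (by positivity)
          rw [inv_le_inv₀ (by positivity) (by positivity)]
          exact pow_le_pow_right₀ h1 hn
  · -- `x < 1`: trivial
    calc min 1 (u⁻¹ ^ j) ≤ 1 := min_le_left _ _
      _ ≤ 1 * (x ^ n)⁻¹ := by
          rw [one_mul, one_le_inv_iff₀]; exact ⟨by positivity, pow_le_one₀ hx.le h1.le⟩
      _ ≤ max 1 (c⁻¹ ^ j) * (x ^ n)⁻¹ := mul_le_mul_of_nonneg_right (le_max_left _ _) (by positivity)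

/-- **Upper bound with decay (Buchholz (2.26), first case), for all `ℓ`**: for every `ℓ` and `n̄` there is
`U` with `|∂_s^ℓ ĉ_k(A+sȦ,κ)| ≤ U / (|p|² (|p| L^{k-1})^{n̄})` for all `1 ≤ k ≤ N+1`, `κ ≠ 0`,
`A ∈ 𝓛(ω₀,Ω₀)`, `‖Ȧ‖ ≤ 1`, `L ≥ 5`, `N ≥ 1`. [cite: Buchholz2016, Thm 2.3 (2.26); Thm 2.4 (v)] -/
theorem exists_baseMult_deriv_le_decay (d : ℕ) (hd : 1 ≤ d) {ω₀ Ω₀ : ℝ} (hω : 0 < ω₀) (hωΩ : ω₀ < Ω₀) (ℓ nbar : ℕ) :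
    ∃ U, 0 ≤ U ∧ ∀ (L N M : ℕ) [NeZero M], 5 ≤ L → 1 ≤ N →
      ∀ A : Matrix (Fin d) (Fin d) ℝ, IsElliptic ω₀ Ω₀ A → ∀ B' : Matrix (Fin d) (Fin d) ℝ, IsUnitSymm B' →
        ∀ k, 1 ≤ k → k ≤ N + 1 → ∀ κ : Fin d → ZMod M, κ ≠ 0 →
          |iteratedDeriv ℓ (fun s : ℝ => baseMult Ω₀ L N k (A + s • B') κ) 0| ≤
            U / (momNorm κ ^ 2 * (momNorm κ * (L : ℝ) ^ (k - 1)) ^ nbar) := by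
  have hΩ := ellipt_Omega_pos hω hωΩ
  obtain ⟨hB, hΩB⟩ := band_pos_of (d := d) hΩ hd
  set B : ℝ := band d Ω₀ with hBdef
  obtain ⟨U1, hU10, hU1⟩ := exists_abs_iteratedDeriv_piece_le ℓ nbar
  obtain ⟨U2, hU20, hU2⟩ := exists_abs_iteratedDeriv_piece_last_le ℓ nbar
  -- `â ≥ c₂ |p|²`, `u = t_{k-1}² â/B ≥ c₄ (|p| L^{k-1})²`
  set c₂ : ℝ := 4 * ω₀ / π ^ 2 with hc₂
  have hc₂pos : 0 < c₂ := by positivity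
  set c₄ : ℝ := c₂ / (256 * B) with hc₄
  have hc₄pos : 0 < c₄ := by positivity
  set K : ℝ := max 1 (c₄⁻¹ ^ nbar) with hK
  set U : ℝ := (ω₀⁻¹) ^ ℓ * (U1 + U2) * K / c₂ with hU
  refine ⟨U, by positivity, fun L N M _ hL hN A hA B' hB' k hk1 hk κ hκ => ?_⟩
  have hs := symbR_spectrum hω hA hκ
  set a := symbR A κ with ha
  have ha0 : 0 < a := hs.1
  have hp := momNorm_pos hκ
  have hL0 : (0 : ℝ) < L := by exact_mod_cast (show 0 < L by omega)
  set x : ℝ := momNorm κ * (L : ℝ) ^ (k - 1) with hx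
  have hxpos : 0 < x := by positivity
  -- the decay factor
  set T : ℝ := (scaleT L (k - 1) : ℝ) with hT
  have hTge : (L : ℝ) ^ (k - 1) / 16 ≤ T := scaleT_ge L (k - 1)
  have hu : c₄ * x ^ 2 ≤ T ^ 2 * a / B := by
    -- `T² a/B ≥ (L^{k-1}/16)² c₂ |p|² / B = c₄ x²`
    have h1 : ((L : ℝ) ^ (k - 1) / 16) ^ 2 ≤ T ^ 2 := pow_le_pow_left₀ (by positivity) hTge 2
    have h2 : c₂ * momNorm κ ^ 2 ≤ a := hs.2.2.1
    rw [hc₄, hx, le_div_iff₀ hB]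
    calc c₂ / (256 * B) * (momNorm κ * (L : ℝ) ^ (k - 1)) ^ 2 * B
        = ((L : ℝ) ^ (k - 1) / 16) ^ 2 * (c₂ * momNorm κ ^ 2) := by field_simp; ring
      _ ≤ T ^ 2 * a := mul_le_mul h1 h2 (by positivity) (by positivity)
  have hdec : min 1 (((T ^ 2 * a / B))⁻¹ ^ nbar) ≤ K * (x ^ nbar)⁻¹ := min_decay_le_pow hc₄pos hxpos hu (by omega)
  have hainv : 1 / a ≤ c₂⁻¹ * (momNorm κ ^ 2)⁻¹ := by
    rw [← mul_inv, one_div, inv_le_inv₀ hs.1 (by positivity)]; exact hs.2.2.1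
  refine (abs_iteratedDeriv_baseMult_le hω hA hB' L N k hκ ℓ).trans ?_
  -- common form: `a^ℓ |c^{(ℓ)}| ≤ (U1+U2) · min(..) / a`
  have hmin0 : 0 ≤ min 1 (((T ^ 2 * a / B))⁻¹ ^ nbar) := le_min zero_le_one (by positivity)
  have hcore : a ^ ℓ * |iteratedDeriv ℓ (piece B L N k) a| ≤ (U1 + U2) * min 1 (((T ^ 2 * a / B))⁻¹ ^ nbar) * (1 / a) := by
    rcases le_or_gt k N with hkN | hkN
    · have h := hU1 B hB L hL N k hk1 hkN a hs.1 hs.2.1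
      rw [← hT] at h
      refine h.trans ?_
      calc U1 * min 1 (((T ^ 2 * a / B))⁻¹ ^ nbar) * min ((scaleT L k : ℝ) ^ 2 / B) (1 / a)
          ≤ U1 * min 1 (((T ^ 2 * a / B))⁻¹ ^ nbar) * (1 / a) :=
            mul_le_mul_of_nonneg_left (min_le_right _ _) (mul_nonneg hU10 hmin0)
        _ ≤ (U1 + U2) * min 1 (((T ^ 2 * a / B))⁻¹ ^ nbar) * (1 / a) := by
            refine mul_le_mul_of_nonneg_right (mul_le_mul_of_nonneg_right (by linarith) hmin0) (by positivity)
    · have hkN1 : k = N + 1 := by omega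
      subst hkN1
      have h := hU2 B hB L hL N hN a hs.1 hs.2.1
      have hT' : T = (scaleT L N : ℝ) := by rw [hT, Nat.add_sub_cancel]
      rw [← hT'] at h
      refine h.trans ?_
      rw [← mul_one_div]
      exact mul_le_mul_of_nonneg_right (mul_le_mul_of_nonneg_right (by linarith) hmin0) (by positivity)
  calc (ω₀⁻¹) ^ ℓ * (a ^ ℓ * |iteratedDeriv ℓ (piece B L N k) a|)
      ≤ (ω₀⁻¹) ^ ℓ * ((U1 + U2) * (K * (x ^ nbar)⁻¹) * (c₂⁻¹ * (momNorm κ ^ 2)⁻¹)) := by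
        refine mul_le_mul_of_nonneg_left (hcore.trans ?_) (by positivity)
        exact mul_le_mul (mul_le_mul_of_nonneg_left hdec (by positivity)) hainv (by positivity) (by positivity)
    _ = U / (momNorm κ ^ 2 * x ^ nbar) := by rw [hU]; field_simp

/-! ## Lower bounds -/

/-- **Lower bound at small momenta (Buchholz (2.27))**: for `1 ≤ k ≤ N`, `κ ≠ 0` with `|p| ≤ L^{-k}`,
`ĉ_k(A,κ) ≥ L^{2k}/(2048 π² B)`. [cite: Buchholz2016, Thm 2.3 (2.27)] -/
theorem baseMult_ge_pow (hd : 1 ≤ d) {ω₀ Ω₀ : ℝ} (hω : 0 < ω₀) (hωΩ : ω₀ < Ω₀) {A : Matrix (Fin d) (Fin d) ℝ}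
    (hA : IsElliptic ω₀ Ω₀ A) {L N k : ℕ} (hL : 5 ≤ L) (hk : k ≤ N) {κ : Fin d → ZMod M}
    (hκ : κ ≠ 0) (hp : momNorm κ ≤ ((L : ℝ) ^ k)⁻¹) :
    (L : ℝ) ^ (2 * k) / (2048 * π ^ 2 * band d Ω₀) ≤ baseMult Ω₀ L N k A κ := by
  have hΩ := ellipt_Omega_pos hω hωΩ
  obtain ⟨hB, hΩB⟩ := band_pos_of (d := d) hΩ hd
  have hs := symbR_spectrum hω hA hκ
  have hL0 : (0 : ℝ) < L := by exact_mod_cast (show 0 < L by omega)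
  refine piece_ge_of_le hB hL hk hs.1 ?_
  -- `â ≤ Ω₀ |p|² ≤ Ω₀ L^{-2k} ≤ B L^{-2k}`
  have h1 : momNorm κ ^ 2 ≤ (((L : ℝ) ^ k)⁻¹) ^ 2 := pow_le_pow_left₀ (momNorm_nonneg κ) hp 2
  calc symbR A κ ≤ Ω₀ * momNorm κ ^ 2 := hs.2.2.2
    _ ≤ band d Ω₀ * (((L : ℝ) ^ k)⁻¹) ^ 2 := mul_le_mul hΩB h1 (sq_nonneg _) hB.le
    _ = band d Ω₀ / (L : ℝ) ^ (2 * k) := by rw [inv_pow, ← pow_mul, mul_comm k 2, div_eq_mul_inv]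

/-- **Global lower bound for the first multiplier (Buchholz (2.27), k = 1)**: for `κ ≠ 0`, `N ≥ 1`,
`ĉ_1(A,κ) ≥ (1024 π² B)^{-1} min(L², |p|^{-2})`. [cite: Buchholz2016, Thm 2.3 (2.27)] -/
theorem baseMult_one_ge (hd : 1 ≤ d) {ω₀ Ω₀ : ℝ} (hω : 0 < ω₀) (hωΩ : ω₀ < Ω₀) {A : Matrix (Fin d) (Fin d) ℝ}
    (hA : IsElliptic ω₀ Ω₀ A) (L : ℕ) {N : ℕ} (hN : 1 ≤ N) {κ : Fin d → ZMod M} (hκ : κ ≠ 0) :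
    1 / (1024 * π ^ 2 * band d Ω₀) * min ((L : ℝ) ^ 2) ((momNorm κ ^ 2)⁻¹) ≤ baseMult Ω₀ L N 1 A κ := by
  have hΩ := ellipt_Omega_pos hω hωΩ
  obtain ⟨hB, hΩB⟩ := band_pos_of (d := d) hΩ hd
  have hs := symbR_spectrum hω hA hκ
  have hp := momNorm_pos hκ
  have h := piece_one_ge hB (L := L) hN hs.1 hs.2.1
  refine le_trans ?_ h
  -- `(1024π²B)^{-1} min(L², |p|^{-2}) ≤ (1024π²)^{-1} min(L²/B, 1/â)` as `1/â ≥ 1/(B|p|²)`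
  rw [show 1 / (1024 * π ^ 2 * band d Ω₀) * min ((L : ℝ) ^ 2) ((momNorm κ ^ 2)⁻¹) =
      1 / (1024 * π ^ 2) * (min ((L : ℝ) ^ 2) ((momNorm κ ^ 2)⁻¹) / band d Ω₀) by field_simp]
  refine mul_le_mul_of_nonneg_left ?_ (by positivity)
  rcases le_total ((L : ℝ) ^ 2) ((momNorm κ ^ 2)⁻¹) with h1 | h1
  · rw [min_eq_left h1]
    refine le_min le_rfl ?_
    -- `L²/B ≤ |p|^{-2}/B ≤ 1/â`
    calc (L : ℝ) ^ 2 / band d Ω₀ ≤ (momNorm κ ^ 2)⁻¹ / band d Ω₀ := div_le_div_of_nonneg_right h1 hB.le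
      _ ≤ 1 / symbR A κ := by
          rw [div_le_div_iff₀ (by positivity) hs.1, one_mul]
          calc (momNorm κ ^ 2)⁻¹ * symbR A κ ≤ (momNorm κ ^ 2)⁻¹ * (Ω₀ * momNorm κ ^ 2) :=
                mul_le_mul_of_nonneg_left hs.2.2.2 (by positivity)
            _ = Ω₀ := by field_simp
            _ ≤ band d Ω₀ := hΩB
  · rw [min_eq_right h1]
    refine le_min (div_le_div_of_nonneg_right h1 hB.le) ?_
    rw [div_le_div_iff₀ (by positivity) hs.1, one_mul]
    calc (momNorm κ ^ 2)⁻¹ * symbR A κ ≤ (momNorm κ ^ 2)⁻¹ * (Ω₀ * momNorm κ ^ 2) :=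
          mul_le_mul_of_nonneg_left hs.2.2.2 (by positivity)
      _ = Ω₀ := by field_simp
      _ ≤ band d Ω₀ := hΩB

end Literature.MathematicalPhysics.StatisticalMechanics.GradientFRD

end
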